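import Summits.AtomisticToContinuum.Crystallization.Theorems.ChartedPlanarOrderTubeChannels

-- PART B of lens-3 g24 `ChartedPlanarOrderTubeChannels.lean` v3 (sha256 3e7f449b59e1cdbe…; this part = its lines 254–495): §4 the finite
-- rearrangement over a box of layer pairs, §5 termwise bounds, §6 the box lower bound, §7 ★★ THE SEAM `isTubeConvex_of_channels`.  Imports PART A.

/-!
# 7c′ᶜ ⟸ CHANNEL DOMINANCE — a typed split beneath the convexity half of slot 7c′, with the seam PROVED (decomp-a2c lens-3 g24, task (x))

Slot 7c′ of lens-4's UniformCut cone is, after (t) `…TubeConvexSplit`, (u) `…StraddleLipschitz`, (v) `…PairModulus` and (w) `…TubeLipschitz`,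
its CONVEXITY HALF 7c′ᶜ `TubeConvexityW' (17/16) (1/40)` alone: the global ℓ²-monotonicity (`IsTubeConvex a b w ρ λ`, `λ > 0`) of the gap-stress
map `h ↦ (gapStress a b m h)_m` on the `ρ`-tube round the increment profile of every admissible zero-gap-stress stacked configuration.

## The split (why CHANNELS and not norms)

Pair the gap-stress difference with `d = h − h'` and rearrange by layer pairs `(k, l)`:
`Σ_m ⟪ΔgapStress_m, d_m⟫ = Σ_{k<l} ⟪ΔF_{kl}, D_{kl}⟫`, `D_{kl} = Σ_{k<i≤l} d_i` (`sum_inner_partial_eq`, `sum_filter_eq_Df`).  ADJACENT pairs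
(`l = k + 1`, `D = d_l`) carry the stiffness; FAR pairs (span `s = l − k ≥ 2`) may soften, and `‖D_{kl}‖² ≤ s Σ_window ‖d_i‖²` costs a factor `s`
per pair and `s` pairs per site, i.e. `s²` per span.  The ISOTROPIC version of this bookkeeping needs `λ₁ > Σ_{s≥2} s² τ_s` with ONE adjacent modulus
`λ₁` against the far pair moduli `τ_s` — that is exactly the scalar own-gap dominance RETIRED by critic R1 / census TAG 161 (numerically thin at
`ρ = 1/40`, false at `ρ ≥ 1/50`): the adjacent secant form is stiff in the NORMAL channel (`k_nn ≈ 20`) and soft in the TANGENTIAL one, while the far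
softening is almost entirely NORMAL.  Census TAG 161b (i) read BLOCKWISE passes with lateral margin `1.66–2.31` at `ρ = 0.04`.  Hence the split is by
CHANNELS with respect to a unit normal `ν` (`tng ν x = x − ⟪ν, x⟫ ν`, `⟪ν, x⟫`), in DIAGONAL form — tangential/normal cross blocks are absorbed
by the certifier with weighted AM–GM (`cross_absorb`: `2 c x y ≤ p x² + q y²` for `c² ≤ p q`), the weight at his choice, per pair type and span:

* ★ CHᴬ `IsAdjacentChannelMono a b w ρ ν λ_T λ_N` — on every tube window the adjacent-layer force map has secant form `≥ λ_T ‖d_T‖² + λ_N d_N²`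
  [CERT: ONE explicit planar lattice sum on ONE ball of radius `ρ`];
* ★ CHꜰ `IsFarChannelModulus a b w ρ ν μ_T μ_N` — for spans `s ≥ 2` the pair force map has secant form `≥ −(μ_T(s) ‖D_T‖² + μ_N(s) D_N²)`
  [CERT for small `s` · ANALYTIC tail, one derivative up from (v)'s `O(s⁻⁶)` Lipschitz span moduli];
* the DOMINANCE is required IN EACH CHANNEL SEPARATELY: `λ + Σ_{s≥2} s² μ_T(s) ≤ λ_T` and `λ + Σ_{s≥2} s² μ_N(s) ≤ λ_N` (`TubeChannelData a b w ρ`;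
  the span-square budgets are uniform bounds `B_T`, `B_N` on the partial sums — no tsum bookkeeping for the consumer).

## Proved here (sorry-free; standard axioms)

* ★★ `isTubeConvex_of_channels` — THE SEAM: straddle summability on the tube + CHᴬ + CHꜰ + channelwise dominance ⇒ `IsTubeConvex a b w ρ λ`
  (finite Fubini over boxes of layer pairs, Jensen on the windows, the window count `sum_window_weight_le`
  (`≤ s` windows of span `s` per site, uniformly in the box), and the limit `R → ∞` through `HasSum` of the straddle families);
  `tubeConvexityData_of_channels` (data level);
* ★ the LEAF STRUCTURE of CHꜰ (§8): `isFarChannelModulus_of_isPairModulus` (Cauchy–Schwarz: a Lipschitz span modulus is an isotropic far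
  channel modulus — adequate for the TAIL of spans only), `IsFarChannelModulusBelow … s₀` (the finitely many spans `< s₀`, CERT),
  `isFarChannelModulus_splice`, `splice_budget`, `tubeChannelData_of_certs` (CHᴬ + finitely many far certificates + one Lipschitz tail with an
  explicit budget + arithmetic ⇒ channel dominance data);
* ★ W′ level: `TubeChannelsW' Λ ρ` / `TubeChannelsW Λ ρ` (binder lists of `TubeConvexW'` / `TubeConvexW` verbatim) and
  `tubeConvexityW'_of_pairModulus_channels : PairModulusW' Λ ρ → TubeChannelsW' Λ ρ → TubeConvexityW' Λ ρ` (tube summability from the pair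
  moduli via (u)'s `summable_famOf_tube`);
* ★ W′-level LEAVES with explicit constant slots (§10): `AdjacentChannelW' Λ ρ λ_T λ_N`, `FarChannelBelowW' Λ ρ μ_T μ_N s₀`,
  `PairModulusTailW' Λ ρ s₀ B₂` (channels w.r.t. any unit normal `ν ⊥ a, b`; `exists_unit_normal` from `cleanStackedIndependentW`) and the glue
  `tubeChannelsW'_of_leaves : … → TubeChannelsW' Λ ρ`; `tubeConvexW'_record_of_leaves` (§11);
* ★★ unconditional in the range of (v)/(w) (`Λ ≤ 17/16`, `ρ < 19/50`): `tubeConvexityW'_of_channels`, `tubeConvexW'_of_channels`,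
  `tubeConvexW'_record_of_channels : TubeChannelsW' (17/16) (1/40) → TubeConvexW' (17/16) (1/40)`, the F2 feeder `tubeUniquenessW_of_channels`,
  the PS column `profileSlavingLJW_of_channels`, and lens-4's RDEF cone with slot 7 = CH: `rdef_of_grossU_shape_gluing_pinning_channels`
  (+ `_record` at `(2, 17/16; 1/40, 3/16)`).

So: SLOT 7c′ ⟸ 7c′ᶜ ⟸ CH `TubeChannelsW' (17/16) (1/40)` ⟸ LEAVES `AdjacentChannelW'` ∧ `FarChannelBelowW' … s₀` ∧ `PairModulusTailW' … s₀ B₂`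
∧ arithmetic, whose content is two families of EXPLICIT-FUNCTION-ON-A-BALL certificates (one adjacent, finitely many far) plus an analytic tail — the block-Toeplitz symbol certificate asked of lens-3 g25 (critic row 472) in secant (derivative-free) form.

Conventions: `E3 = EuclideanSpace ℝ (Fin 3)` (`…ChunkFloor.E3`); `tube`, `incr`, `gapStress`, `offsetOf`, `layerForce`, `Straddle` from
`…ProfileSlavingLJ`; `famOf` from `…TubeMonotoneSplit`.  No instances, no notation, no new axioms.
-/

noncomputable section

namespace Summit.AtomisticToContinuum.Crystallization.Theorems.ChartedPlanarOrderTubeChannels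

open Finset Metric Filter Topology
open scoped RealInnerProductSpace
open Summit.AtomisticToContinuum.Crystallization.Theorems.ChartedPlanarOrderChunkFloor (E3)
open Summit.AtomisticToContinuum.Crystallization.Theorems.ChartedPlanarOrderProfileSlavingLJ (Straddle IsStacked gapStress incr tube
  offsetOf layerForce)
open Summit.AtomisticToContinuum.Crystallization.Theorems.ChartedPlanarOrderTubeMonotoneSplit (IsPairModulus famOf gapStress_eq_tsum
  offsetOf_pred)
open Summit.AtomisticToContinuum.Crystallization.Theorems.ChartedPlanarOrderTubeConvex (IsTubeConvex)
open Summit.AtomisticToContinuum.Crystallization.Theorems.ChartedPlanarOrderTubeConvexSplit (TubeConvexityData)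

/-! ## §4 The finite rearrangement over a box of layer pairs -/

section Rearrangement

variable {a b : E3} {w : ℤ → E3} {ρ : ℝ}

/-- the pair force difference of two increment profiles across the layer pair `q = (k, l)`. -/
def Xf (a b : E3) (h h' : ℤ → E3) (q : ℤ × ℤ) : E3 :=
  layerForce a b (-offsetOf h q.1 q.2) - layerForce a b (-offsetOf h' q.1 q.2)

/-- the relative-offset difference of two increment profiles across the layer pair `q = (k, l)`. -/
def Df (h h' : ℤ → E3) (q : ℤ × ℤ) : E3 := offsetOf h q.1 q.2 - offsetOf h' q.1 q.2

/-- the straddling pairs of gap `m` inside the box `[-R, R]²`. -/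
def SB (m : ℤ) (R : ℕ) : Finset (Straddle m) := (box R).subtype (fun q : ℤ × ℤ => q.1 < m ∧ m ≤ q.2)

/-- Membership in the straddling-pair window `SB m R`. [folklore] -/
theorem mem_SB {m : ℤ} {R : ℕ} {p : Straddle m} : p ∈ SB m R ↔ p.1 ∈ box R :=
  Finset.mem_subtype

/-- `SB m` is monotone in the radius. [folklore] -/
theorem SB_mono (m : ℤ) : Monotone (SB m) := by
  intro R R' hRR' p hp
  rw [mem_SB] at hp ⊢
  exact box_mono hRR' hp

/-- `SB m R` exhausts the straddling pairs as `R → ∞`. [folklore] -/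
theorem tendsto_SB (m : ℤ) : Tendsto (SB m) atTop atTop := by
  refine tendsto_atTop_finset_of_monotone (SB_mono m) fun p => ?_
  refine ⟨max p.1.1.natAbs p.1.2.natAbs, ?_⟩
  rw [mem_SB, mem_box]
  refine ⟨⟨by omega, by omega⟩, by omega, by omega⟩

/-- The difference of two families is the difference family `Xf`. [folklore] -/
theorem famOf_sub_eq (m : ℤ) (h h' : ℤ → E3) (p : Straddle m) :
    famOf a b m h p - famOf a b m h' p = Xf a b h h' p.1 := rfl

/-- The window sum over `SB m R`, rewritten. [folklore] -/
theorem sum_SB_eq (m : ℤ) (R : ℕ) (h h' : ℤ → E3) :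
    ∑ p ∈ SB m R, (famOf a b m h p - famOf a b m h' p) = ∑ q ∈ (box R).filter (fun q => q.1 < m ∧ m ≤ q.2), Xf a b h h' q := by
  simp only [famOf_sub_eq, SB]
  exact Finset.sum_subtype_eq_sum_filter (Xf a b h h')

/-- ★ the finite rearrangement: gap-indexed partial sums paired with `d` = pair-indexed sums paired with the windowed sums of `d`. -/
theorem sum_inner_partial_eq (F : Finset ℤ) (d : ℤ → E3) (h h' : ℤ → E3) (R : ℕ) :
    ∑ m ∈ F, ⟪∑ p ∈ SB m R, (famOf a b m h p - famOf a b m h' p), d m⟫ =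
      ∑ q ∈ box R, ⟪Xf a b h h' q, ∑ m ∈ F.filter (fun m => q.1 < m ∧ m ≤ q.2), d m⟫ := by
  calc ∑ m ∈ F, ⟪∑ p ∈ SB m R, (famOf a b m h p - famOf a b m h' p), d m⟫
      = ∑ m ∈ F, ∑ q ∈ (box R).filter (fun q => q.1 < m ∧ m ≤ q.2), ⟪Xf a b h h' q, d m⟫ := by
        refine Finset.sum_congr rfl fun m _ => ?_
        rw [sum_SB_eq, sum_inner]
    _ = ∑ m ∈ F, ∑ q ∈ box R, (if q.1 < m ∧ m ≤ q.2 then ⟪Xf a b h h' q, d m⟫ else 0) := by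
        refine Finset.sum_congr rfl fun m _ => ?_
        rw [Finset.sum_filter]
    _ = ∑ q ∈ box R, ∑ m ∈ F, (if q.1 < m ∧ m ≤ q.2 then ⟪Xf a b h h' q, d m⟫ else 0) := Finset.sum_comm
    _ = ∑ q ∈ box R, ⟪Xf a b h h' q, ∑ m ∈ F.filter (fun m => q.1 < m ∧ m ≤ q.2), d m⟫ := by
        refine Finset.sum_congr rfl fun q _ => ?_
        rw [inner_sum, Finset.sum_filter]

/-- the windowed sum of a finitely supported difference is the relative-offset difference. -/
theorem sum_filter_eq_Df {F : Finset ℤ} {h h' : ℤ → E3} (hoff : ∀ k, k ∉ F → h k = h' k) (q : ℤ × ℤ) :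
    ∑ m ∈ F.filter (fun m => q.1 < m ∧ m ≤ q.2), (h m - h' m) = Df h h' q := by
  unfold Df offsetOf
  rw [← Finset.sum_sub_distrib, ← Finset.sum_filter_add_sum_filter_not (Ioc q.1 q.2) (fun i => i ∈ F)]
  have h0 : ∑ i ∈ (Ioc q.1 q.2).filter (fun i => ¬ i ∈ F), (h i - h' i) = 0 :=
    Finset.sum_eq_zero fun i hi => by rw [hoff i (Finset.mem_filter.mp hi).2, sub_self]
  rw [h0, add_zero]
  congr 1
  ext i
  simp only [Finset.mem_filter, Finset.mem_Ioc]
  tauto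

/-- `Df` as a sum of increments over `Ioc`. [folklore] -/
theorem Df_eq_sum (h h' : ℤ → E3) (q : ℤ × ℤ) : Df h h' q = ∑ i ∈ Ioc q.1 q.2, (h i - h' i) := by
  unfold Df offsetOf
  rw [Finset.sum_sub_distrib]

/-- `Xf` vanishes on non-straddling index pairs. [folklore] -/
theorem Xf_eq_zero_of_not_lt {h h' : ℤ → E3} {q : ℤ × ℤ} (hq : ¬ q.1 < q.2) : Xf a b h h' q = 0 := by
  unfold Xf offsetOf
  rw [Finset.Ioc_eq_empty_of_le (not_lt.mp hq), Finset.sum_empty, Finset.sum_empty, sub_self]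

/-- The offset of an adjacent pair is the single increment. [folklore] -/
theorem offsetOf_adj (h : ℤ → E3) {q : ℤ × ℤ} (hq : q.2 = q.1 + 1) : offsetOf h q.1 q.2 = h q.2 := by
  have : q.1 = q.2 - 1 := by omega
  rw [this]
  exact offsetOf_pred h q.2

/-! ## §5 Termwise lower bounds -/

variable {ν : E3} {lT lN : ℝ} {μT μN : ℕ → ℝ}

/-- adjacent pairs: `λ_T ‖d_T‖² + λ_N d_N² ≤ ⟪X, D⟫`. -/
theorem adj_term (hA : IsAdjacentChannelMono a b w ρ ν lT lN) {h h' : ℤ → E3} (hh : ∀ i, h i ∈ tube w ρ i)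
    (hh' : ∀ i, h' i ∈ tube w ρ i) {q : ℤ × ℤ} (hq : q.2 = q.1 + 1) :
    lT * ‖tng ν (h q.2 - h' q.2)‖ ^ 2 + lN * ⟪ν, h q.2 - h' q.2⟫ ^ 2 ≤ ⟪Xf a b h h' q, Df h h' q⟫ := by
  have h1 := hA q.2 (h q.2) (hh q.2) (h' q.2) (hh' q.2)
  simp only [Xf, Df, offsetOf_adj _ hq]
  exact h1

/-- far pairs: `−(s μ_T(s) Σ_window ‖d_T‖² + s μ_N(s) Σ_window d_N²) ≤ ⟪X, D⟫` (Jensen on the window). -/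
theorem far_term (hF : IsFarChannelModulus a b w ρ ν μT μN) (hμT : ∀ s, 0 ≤ μT s) (hμN : ∀ s, 0 ≤ μN s)
    {h h' : ℤ → E3} (hh : ∀ i, h i ∈ tube w ρ i) (hh' : ∀ i, h' i ∈ tube w ρ i) {q : ℤ × ℤ} (hq : q.1 + 2 ≤ q.2) :
    -(((q.2 - q.1).toNat : ℝ) * μT (q.2 - q.1).toNat * ∑ i ∈ Ioc q.1 q.2, ‖tng ν (h i - h' i)‖ ^ 2 +
      ((q.2 - q.1).toNat : ℝ) * μN (q.2 - q.1).toNat * ∑ i ∈ Ioc q.1 q.2, ⟪ν, h i - h' i⟫ ^ 2) ≤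
      ⟪Xf a b h h' q, Df h h' q⟫ := by
  have h1 := hF q.1 q.2 hq h h' hh hh'
  change -(μT (q.2 - q.1).toNat * ‖tng ν (Df h h' q)‖ ^ 2 + μN (q.2 - q.1).toNat * ⟪ν, Df h h' q⟫ ^ 2) ≤
    ⟪Xf a b h h' q, Df h h' q⟫ at h1
  refine le_trans (neg_le_neg ?_) h1
  set s := (q.2 - q.1).toNat with hs
  have hT : ‖tng ν (Df h h' q)‖ ^ 2 ≤ (s : ℝ) * ∑ i ∈ Ioc q.1 q.2, ‖tng ν (h i - h' i)‖ ^ 2 := by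
    rw [Df_eq_sum, tng_sum, ← card_Ioc_real]
    exact norm_sum_sq_le _ _
  have hN : ⟪ν, Df h h' q⟫ ^ 2 ≤ (s : ℝ) * ∑ i ∈ Ioc q.1 q.2, ⟪ν, h i - h' i⟫ ^ 2 := by
    rw [Df_eq_sum, inner_sum, ← card_Ioc_real]
    exact sq_sum_le_card_mul_sum_sq
  have h2 : μT s * ‖tng ν (Df h h' q)‖ ^ 2 ≤ μT s * ((s : ℝ) * ∑ i ∈ Ioc q.1 q.2, ‖tng ν (h i - h' i)‖ ^ 2) :=
    mul_le_mul_of_nonneg_left hT (hμT s)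
  have h3 : μN s * ⟪ν, Df h h' q⟫ ^ 2 ≤ μN s * ((s : ℝ) * ∑ i ∈ Ioc q.1 q.2, ⟪ν, h i - h' i⟫ ^ 2) :=
    mul_le_mul_of_nonneg_left hN (hμN s)
  linarith

/-! ## §6 The lower bound on a large box -/

/-- ★ on every box containing the support with a margin, the pair-indexed sum is `≥ λ Σ ‖d‖²`. -/
theorem lower_bound_box {lam BT BN : ℝ} (hν : ‖ν‖ = 1) (hA : IsAdjacentChannelMono a b w ρ ν lT lN)
    (hF : IsFarChannelModulus a b w ρ ν μT μN) (hμT : ∀ s, 0 ≤ μT s) (hμN : ∀ s, 0 ≤ μN s)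
    (hBT : ∀ N : ℕ, ∑ s ∈ Finset.Ico 2 N, ((s : ℕ) : ℝ) ^ 2 * μT s ≤ BT)
    (hBN : ∀ N : ℕ, ∑ s ∈ Finset.Ico 2 N, ((s : ℕ) : ℝ) ^ 2 * μN s ≤ BN)
    (hlam : 0 ≤ lam) (hlamT : lam + BT ≤ lT) (hlamN : lam + BN ≤ lN)
    {F : Finset ℤ} {h h' : ℤ → E3} (hh : ∀ i, h i ∈ tube w ρ i) (hh' : ∀ i, h' i ∈ tube w ρ i)
    (hoff : ∀ k, k ∉ F → h k = h' k) {R : ℕ} (hR : ∀ m ∈ F, -(R : ℤ) + 1 ≤ m ∧ m ≤ R) :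
    lam * ∑ m ∈ F, ‖h m - h' m‖ ^ 2 ≤ ∑ q ∈ box R, ⟪Xf a b h h' q, Df h h' q⟫ := by
  have hBT0 : 0 ≤ BT := by simpa using hBT 0
  have hBN0 : 0 ≤ BN := by simpa using hBN 0
  set gT : ℤ → ℝ := fun i => ‖tng ν (h i - h' i)‖ ^ 2 with hgT
  set gN : ℤ → ℝ := fun i => ⟪ν, h i - h' i⟫ ^ 2 with hgN
  have hgT0 : ∀ i, 0 ≤ gT i := fun i => by positivity
  have hgN0 : ∀ i, 0 ≤ gN i := fun i => by positivity
  have hgTF : ∀ i, i ∉ F → gT i = 0 := fun i hi => by simp [hgT, hoff i hi, tng_zero]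
  have hgNF : ∀ i, i ∉ F → gN i = 0 := fun i hi => by simp [hgN, hoff i hi]
  have hFI : F ⊆ Icc (-(R : ℤ)) R := fun m hm => by
    rw [Finset.mem_Icc]; constructor <;> linarith [(hR m hm).1, (hR m hm).2]
  -- Pythagoras: `Σ ‖d‖² = Σ gT + Σ gN`
  have hsplit : ∑ m ∈ F, ‖h m - h' m‖ ^ 2 = ∑ m ∈ F, gT m + ∑ m ∈ F, gN m := by
    rw [← Finset.sum_add_distrib]
    exact Finset.sum_congr rfl fun m _ => norm_sq_channels hν _
  -- split the box into: not `k < l` (zero), adjacent, far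
  have hzero : ∑ q ∈ (box R).filter (fun q => ¬ q.1 < q.2), ⟪Xf a b h h' q, Df h h' q⟫ = 0 :=
    Finset.sum_eq_zero fun q hq => by rw [Xf_eq_zero_of_not_lt (Finset.mem_filter.mp hq).2, inner_zero_left]
  have hAF : ((box R).filter (fun q => q.1 < q.2)).filter (fun q => q.2 = q.1 + 1) = (box R).filter (fun q => q.2 = q.1 + 1) := by
    ext q; simp only [Finset.mem_filter]; constructor
    · rintro ⟨⟨h1, -⟩, h2⟩; exact ⟨h1, h2⟩
    · rintro ⟨h1, h2⟩; exact ⟨⟨h1, by omega⟩, h2⟩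
  have hPF : ((box R).filter (fun q => q.1 < q.2)).filter (fun q => ¬ q.2 = q.1 + 1) = far R := by
    ext q; simp only [far, Finset.mem_filter]; constructor
    · rintro ⟨⟨h1, h2⟩, h3⟩; exact ⟨h1, by omega⟩
    · rintro ⟨h1, h2⟩; exact ⟨⟨h1, by omega⟩, by omega⟩
  -- adjacent part
  have hadj : ∑ m ∈ F, (lT * gT m + lN * gN m) ≤ ∑ q ∈ (box R).filter (fun q => q.2 = q.1 + 1), ⟪Xf a b h h' q, Df h h' q⟫ := by
    have himg : ∑ m ∈ F, (lT * gT m + lN * gN m) =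
        ∑ q ∈ F.image (fun m => (m - 1, m)), (lT * gT q.2 + lN * gN q.2) := by
      rw [Finset.sum_image]
      intro m _ m' _ hmm'
      simpa using congrArg Prod.snd hmm'
    rw [himg]
    have hsub : F.image (fun m => (m - 1, m)) ⊆ (box R).filter (fun q => q.2 = q.1 + 1) := by
      intro q hq
      obtain ⟨m, hm, rfl⟩ := Finset.mem_image.mp hq
      rw [Finset.mem_filter, mem_box]
      obtain ⟨h1, h2⟩ := hR m hm
      refine ⟨⟨⟨by simp only; omega, by simp only; omega⟩, by simp only; omega, by simpa using h2⟩, by simp⟩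
    refine (Finset.sum_le_sum_of_subset_of_nonneg hsub fun q _ _ => ?_).trans (Finset.sum_le_sum fun q hq => ?_)
    · exact add_nonneg (mul_nonneg (by linarith) (hgT0 _)) (mul_nonneg (by linarith) (hgN0 _))
    · exact adj_term hA hh hh' (Finset.mem_filter.mp hq).2
  -- far part
  have hfarT := sum_far_window_le (c := μT) hμT hBT hgT0 hgTF hFI
  have hfarN := sum_far_window_le (c := μN) hμN hBN hgN0 hgNF hFI
  have hfar : -(BT * ∑ m ∈ F, gT m + BN * ∑ m ∈ F, gN m) ≤ ∑ q ∈ far R, ⟪Xf a b h h' q, Df h h' q⟫ := by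
    have h1 : ∑ q ∈ far R, -(((q.2 - q.1).toNat : ℝ) * μT (q.2 - q.1).toNat * ∑ i ∈ Ioc q.1 q.2, gT i +
        ((q.2 - q.1).toNat : ℝ) * μN (q.2 - q.1).toNat * ∑ i ∈ Ioc q.1 q.2, gN i) ≤
        ∑ q ∈ far R, ⟪Xf a b h h' q, Df h h' q⟫ :=
      Finset.sum_le_sum fun q hq => far_term hF hμT hμN hh hh' (Finset.mem_filter.mp hq).2
    refine le_trans ?_ h1
    rw [Finset.sum_neg_distrib, Finset.sum_add_distrib]
    linarith
  -- assemble
  rw [← Finset.sum_filter_add_sum_filter_not (box R) (fun q => q.1 < q.2), hzero, add_zero,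
    ← Finset.sum_filter_add_sum_filter_not ((box R).filter (fun q => q.1 < q.2)) (fun q => q.2 = q.1 + 1), hAF, hPF, hsplit]
  have hGT0 : 0 ≤ ∑ m ∈ F, gT m := Finset.sum_nonneg fun i _ => hgT0 i
  have hGN0 : 0 ≤ ∑ m ∈ F, gN m := Finset.sum_nonneg fun i _ => hgN0 i
  have hcoef : lam * (∑ m ∈ F, gT m + ∑ m ∈ F, gN m) ≤
      ∑ m ∈ F, (lT * gT m + lN * gN m) - (BT * ∑ m ∈ F, gT m + BN * ∑ m ∈ F, gN m) := by
    rw [Finset.sum_add_distrib, ← Finset.mul_sum, ← Finset.mul_sum]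
    nlinarith
  linarith

end Rearrangement

/-! ## §7 ★ The seam: channel dominance ⇒ ℓ²-monotonicity of the whole gap-stress map -/

section Seam

variable {a b : E3} {w : ℤ → E3} {ρ : ℝ}

/-- ★★ **the channel seam** (PROVED): straddle summability on the tube + adjacent channel monotonicity + far channel moduli dominated
IN EACH CHANNEL ⇒ `IsTubeConvex a b w ρ λ`.  Proof: pair the gap-indexed partial sums over the boxes `[-R, R]²` with `d = h − h'`,
rearrange to pair-indexed sums (finite Fubini), bound adjacent pairs below by `(λ_T, λ_N)` and far pairs by `−s μ(s)` times
the windowed channel energies (Jensen), count windows (`≤ s` per site and span), and pass to the limit `R → ∞`. -/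
theorem isTubeConvex_of_channels {ν : E3} {lT lN lam BT BN : ℝ} {μT μN : ℕ → ℝ}
    (hS : ∀ (m : ℤ) (h : ℤ → E3), (∀ i, h i ∈ tube w ρ i) → Summable (famOf a b m h))
    (hν : ‖ν‖ = 1) (hμT : ∀ s, 0 ≤ μT s) (hμN : ∀ s, 0 ≤ μN s)
    (hBT : ∀ N : ℕ, ∑ s ∈ Finset.Ico 2 N, ((s : ℕ) : ℝ) ^ 2 * μT s ≤ BT)
    (hBN : ∀ N : ℕ, ∑ s ∈ Finset.Ico 2 N, ((s : ℕ) : ℝ) ^ 2 * μN s ≤ BN)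
    (hlam : 0 ≤ lam) (hlamT : lam + BT ≤ lT) (hlamN : lam + BN ≤ lN)
    (hA : IsAdjacentChannelMono a b w ρ ν lT lN) (hF : IsFarChannelModulus a b w ρ ν μT μN) :
    IsTubeConvex a b w ρ lam := by
  intro F h h' hh hh' hoff
  have hs : ∀ m : ℤ, HasSum (fun p : Straddle m => famOf a b m h p - famOf a b m h' p)
      (gapStress a b m h - gapStress a b m h') := fun m => by
    rw [gapStress_eq_tsum, gapStress_eq_tsum]
    exact (hS m h hh).hasSum.sub (hS m h' hh').hasSum
  have hT : ∀ m : ℤ, Tendsto (fun R : ℕ => ∑ p ∈ SB m R, (famOf a b m h p - famOf a b m h' p)) atTop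
      (𝓝 (gapStress a b m h - gapStress a b m h')) := fun m => by
    have h1 := hs m
    rw [HasSum, SummationFilter.unconditional_filter] at h1
    exact h1.comp (tendsto_SB m)
  have hTot : Tendsto (fun R : ℕ => ∑ m ∈ F, ⟪∑ p ∈ SB m R, (famOf a b m h p - famOf a b m h' p), h m - h' m⟫) atTop
      (𝓝 (∑ m ∈ F, ⟪gapStress a b m h - gapStress a b m h', h m - h' m⟫)) :=
    tendsto_finsetSum F fun m _ => (hT m).inner tendsto_const_nhds
  refine ge_of_tendsto hTot (eventually_atTop.2 ⟨F.sup (fun m : ℤ => m.natAbs) + 1, fun R hR => ?_⟩)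
  have hR' : ∀ m ∈ F, -(R : ℤ) + 1 ≤ m ∧ m ≤ R := fun m hm => by
    have h1 : m.natAbs ≤ F.sup (fun m : ℤ => m.natAbs) := Finset.le_sup (f := fun m : ℤ => m.natAbs) hm
    constructor <;> omega
  have hE : ∑ q ∈ box R, ⟪Xf a b h h' q, ∑ m ∈ F.filter (fun m => q.1 < m ∧ m ≤ q.2), (h m - h' m)⟫ =
      ∑ q ∈ box R, ⟪Xf a b h h' q, Df h h' q⟫ :=
    Finset.sum_congr rfl fun q _ => by rw [sum_filter_eq_Df hoff q]
  rw [sum_inner_partial_eq, hE]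
  exact lower_bound_box hν hA hF hμT hμN hBT hBN hlam hlamT hlamN hh hh' hoff hR'

/-- ★★ data level: channel dominance data + tube summability ⇒ 7c′ᶜ data `TubeConvexityData a b w ρ`. -/
theorem tubeConvexityData_of_channels
    (hS : ∀ (m : ℤ) (h : ℤ → E3), (∀ i, h i ∈ tube w ρ i) → Summable (famOf a b m h))
    (hD : TubeChannelData a b w ρ) : TubeConvexityData a b w ρ := by
  obtain ⟨ν, lT, lN, lam, BT, BN, μT, μN, hν, hμT, hμN, hBT, hBN, hlam, hlamT, hlamN, hA, hF⟩ := hD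
  exact ⟨lam, hlam, isTubeConvex_of_channels hS hν hμT hμN hBT hBN hlam.le hlamT hlamN hA hF⟩

end Seam

end Summit.AtomisticToContinuum.Crystallization.Theorems.ChartedPlanarOrderTubeChannels
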